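import Summits.ABC.IUTFork.Thm311RealInd1StripPacketDualBoxVolumeUnion
import Summits.ABC.IUTFork.Thm311RealInd1StripPacketDualBoxSharpIff
import HarnessLib

/-!
# [IUTchIII] Thm 3.11 (i) (Ind1)+(Ind2) ⟶ Cor 3.12, READING (U): the tame dichotomy for the (Ind1)-SLOT-UNION region as ONE displayed equivalence —
# the `(R_I)^∼`-hull of every factorwise-strip orbit of `⋃_a ι_a(g_a)·(R_I)^∼` IS the Dupuy–Hilado container `packetHull(p^{min_a A_a}·log_p(R_I^×))`
# IF AND ONLY IF SOME content-minimising slot satisfies its room inequality (mixed collections included; ⟸ mod `JannsenWingbergMappingClass`, ⟹ unconditional)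

PROOF-ONLY file (abc-iut cell, Cor. 3.12 sub-crew, seat abc-iut-c312-1 = holder of record of the typed [IUTchIII] Thm. 3.11, gen 22; offer (ρ)
«C:DICHOTOMY-IFF», file 1 — the reading-(U) twin of R28 (λ3) `Thm311RealInd1StripPacketDualBoxSharpIff` (p574787), over gen 21's (π′4)
`Thm311RealInd1StripPacketDualBoxVolumeUnion` (p584698)).  TAKES NO SIDE on [IUTchIII] Cor. 3.12.  No definition, no `Prop` fact.  CONDITIONAL on
`JannsenWingbergMappingClass` (displayed binder `hMC`) ONLY in the direction room ⟹ identity, exactly where R25 (A) carries it; identity ⟹ room is UNCONDITIONAL.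

SETTING.  Genuine packet `X = ⊗_{i∈I} K_{w_i}`, every factor TAME (`p > 2`, `e_i ≤ p − 2`) of ODD local degree `≥ 3` and ANY residue degree; slot elements `g_a`
with `‖g_a‖ = p^{−v_a/e_a}`, contents `A_a = (v_a − 1) div e_a + 1 − |I|`, `m = min_a A_a`; the (Ind1)-slot union `M_U = ⋃_a ι_a(g_a)·(R_I)^∼` (at a genuine
place-section collection: `⋃_σ σ·O_𝕃(−P_Θ)_{v⃗∘σ}`, abc-iut-c312-3 `realPrimePacketWith_indOneUnion_pilotRegion_eq_slotUnion`), whose hull of ALL possible images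
is `packetHull(p^{m}·log_p(R_I^×))` (R23 `GenuineLogThetaUnionTameContent`, unconditional).  Bits: a set `S` of factors where the bit is AVAILABLE (`hbit`: at each
`i ∈ S` with `f_i = 1` some realised strip automorphism moves `ℤ_p·p` modulo `p·log_p(𝒪^×)`), resp. a bit ORACLE `bit : I → Prop` correct at the residue-degree-one
factors (`hbit`/`hfix`) and NOT READ where `f_i > 1`, `S := {i : f_i ≠ 1 ∨ bit_i}` (R28 (λ3)'s shape verbatim).  `H ≤ indTwo` contains the single-factor strip
moves (identity side) and acts factorwise through the realised strip groups (converse side) — jointly inhabited, R28 (λ3) `exists_subgroup_le_indTwo_stripMoves_factorwise`.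

* §1 **`packetHull_iUnion_image_iUnion_iota_smul_normalizedPacket_eq_of_bitsOn_at_min_of_jannsenWingbergMappingClass`** — bits on `S` and the room inequality
  `((v_{a₀}−1) % e_{a₀} + 1)/e_{a₀} + Σ_{i∉S} 1/e_i ≤ 1` at ONE content-minimising slot `a₀` ⟹ `packetHull(H-orbit of M_U) = packetHull(p^{m}·log_p(R_I^×))`
  (mod hMC): upper bound = the content of the slot union (c312-5/R23 `TameContent`, unconditional), lower bound = R25 (A)
  `packetHull_iUnion_image_iota_smul_normalizedPacket_eq_of_bitsOn_of_jannsenWingbergMappingClass` AT `a₀` (the `H`-orbit of `ι_{a₀}(g_{a₀})·(R_I)^∼ ⊆ M_U` already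
  has hull `packetHull(p^{A_{a₀}}·L)`, `A_{a₀} = m`).  The OTHER minimising slots may FAIL their room inequality: this is the «mixed collections» case left open by
  (π′4), and it lands on the identity side.
* §2 **`packetHull_orbit_slotUnion_eq_container_iff_exists_room_at_min_of_jannsenWingbergMappingClass`** — THE READING-(U) EQUIVALENCE:
  `packetHull(H-orbit of M_U) = packetHull(p^{m}·log_p(R_I^×)) ⟺ ∃ a, A_a = m ∧ ((v_a−1) % e_a + 1)/e_a + Σ_{i∉S} 1/e_i ≤ 1` (⟸ §1, mod hMC; ⟹ UNCONDITIONAL: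
  if NO minimising slot has room, gen 21's (π′4) `packetLogμ_packetHull_orbit_slotUnion_le_container_sub_of_not_room_at_min` puts `log μ̄(hull)` at least
  `(Σ_j f(L_j)/D)·log p > 0` (`margin_pos`) below the container's, so the hulls differ).  No third case.
* §3 place-section ports at a genuine collection `v⃗` of a place section (any shell normalisation `c`):
  **`localFields_packetHull_orbitH_indOneUnion_pilotRegion_eq_possibleImagesHull_of_bitsOn_at_min_…`** and
  **`localFields_packetHull_orbitH_indOneUnion_pilotRegion_eq_possibleImagesHull_iff_exists_room_at_min_…`** (`hull(H-orbit of ⋃_σ σ·O_𝕃(−P_Θ)_{v⃗∘σ}) =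
  possibleImagesHull ⟺ …`) — consumed by file 2 at the `ln ν̄_{𝕃_p}` level.
READING (numbers about OUR typed objects; neutral): R23 (identity where every factor has `f ≠ 1` / residue forms) and (π′4) (strict log-volume gap where NO
minimising slot has room) are the two sides of ONE dichotomy in reading (U): the hull of the (Ind1)-slot-union orbit under any factorwise-strip `H ≤ indTwo`
containing the single-factor strip moves is the container's exactly when SOME content-minimising slot has room — decided by the ramification indices, the
residues `(v_a − 1) mod e_a` at the minimising slots and the set of residue-degree-one factors whose bit holds.  Which value a bit takes at a given place is NOT
claimed; HONEST SCOPE: ⟸ mod `JannsenWingbergMappingClass`, ⟹ unconditional; OUR typings (THE equivariant lift, THE logarithm, factorwise action; F-B28-1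
untouched); EVEN degree, WILD, `p = 2` outside; equal-AS-TYPED ≠ equal in print; nothing here asserts that abc is proved or refuted; no side taken on [IUTchIII]
Cor. 3.12 / [IUTchIV] Thm. 1.10, on (U) vs (P), or on any author. [claim: Mochizuki2012, status: disputed]; [cite: Mochizuki2012, IUTchIII Thm. 3.11 (i) p. 154;
Rmk. 3.9.5 (i) p. 127; Cor. 3.12 p. 174, Steps (x)/(xi) pp. 181–183; IUTchIV Prop. 1.1 p. 9, Prop. 1.2 (ii) pp. 10–11, Prop. 1.4 (iii) p. 13];
[cite: Kondo2025OuterAutMLF, §3 Thm 3.17, Rem 3.18]; [cite: DupuyHilado2025, §4.7, §4.9, §4.11, §4.12]. typed ≠ proved; a conditional theorem discharges nothing it binds.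
-/

set_option autoImplicit false

noncomputable section

open Metric Set Function Module
open scoped Pointwise TensorProduct

namespace Summit.ABC.IUTFork.Thm311.Real

open NumberField IsDedekindDomain Literature.NumberTheory.NumberFields Literature.IUT.LogVolume
open Literature.NumberTheory.GaloisRepresentations Literature.NumberTheory.GaloisRepresentations.Ultrametric
open Literature.AnabelianGeometry.AbsoluteAnabelian Literature.IUT.HodgeArakelov
open Literature.IUT.HodgeArakelov.AbsTopMonoids

/-! ## §1 Packet level: the union identity from bits on `S` and room at ONE content-minimising slot -/

section GenuineFactors

variable {K : Type} [Field K] [NumberField K] (p : ℕ) [hp : Fact p.Prime]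
variable {I : Type} [Fintype I] [DecidableEq I] (w : I → HeightOneSpectrum (𝓞 K)) (hw : ∀ i, ((p : ℕ) : 𝓞 K) ∈ (w i).asIdeal)

/-- **THE UNION IDENTITY FROM BITS ON `S` AND ROOM AT ONE CONTENT-MINIMISING SLOT (modulo `JannsenWingbergMappingClass`).**  Genuine packet `⊗_i K_{w_i}`,
every factor TAME of ODD local degree `≥ 3`, ANY residue degrees; slot elements `‖g_a‖ = p^{−v_a/e_a}`; bits available on `S` (asked only where `f_i = 1`);
`a₀` a content-minimising slot (`(v_{a₀}−1) div e_{a₀} ≤ (v_a−1) div e_a` for every `a`) at which the room inequality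
`((v_{a₀}−1) % e_{a₀} + 1)/e_{a₀} + Σ_{i∉S} 1/e_i ≤ 1` holds — nothing is asked of the other slots.  Then for every `H ≤ indTwo` containing the
single-factor (Ind1) strip moves, `packetHull(⋃_{γ∈H} γ(⋃_a ι_a(g_a)·(R_I)^∼)) = packetHull(p^{min_a A_a}·log_p(R_I^×))`, `A_a = (v_a−1) div e_a + 1 − |I|`
(upper: the content of the slot union, unconditional; lower: R25 (A) at the slot `a₀`, whose region lies in the union).
[claim: Mochizuki2012, status: disputed] [cite: Mochizuki2012, IUTchIII Thm. 3.11 (i) p. 154; Cor. 3.12 p. 174, Step (xi) p. 183; IUTchIV Prop. 1.2 (ii) pp. 10–11]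
[cite: Kondo2025OuterAutMLF, §3 Thm 3.17, Rem 3.18] [cite: DupuyHilado2025, §4.7, §4.9, §4.11, §4.12] -/
theorem packetHull_iUnion_image_iUnion_iota_smul_normalizedPacket_eq_of_bitsOn_at_min_of_jannsenWingbergMappingClass [Nonempty I]
    (hMC : JannsenWingbergMappingClass) (hp2 : 2 < p)
    (he : ∀ i, absRamificationIdx p (RescaledCompletion K p (w i) (hw i)) ≤ p - 2)
    (h3 : ∀ i, 3 ≤ localDeg K (w i)) (hodd : ∀ i, Odd (localDeg K (w i)))
    (g : Π i, RescaledCompletion K p (w i) (hw i)) (v : I → ℤ)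
    (hg : ∀ i, ‖g i‖ = (p : ℝ) ^ (-(v i / (absRamificationIdx p (RescaledCompletion K p (w i) (hw i)) : ℝ))))
    (S : Finset I)
    (hbit : ∀ i ∈ S, (w i).asIdeal.inertiaDeg ℤ = 1 →
      ∃ ψ ∈ ind1StripOf (w i) (galoisLog (w i)),
        RescaledCompletion.of K p (w i) (hw i) (ψ (p : (w i).adicCompletion K)) - (p : RescaledCompletion K p (w i) (hw i)) ∉
          (p : ℚ_[p]) • logUnits (RescaledCompletion K p (w i) (hw i)))
    (a₀ : I)
    (ha₀ : ∀ a, (v a₀ - 1) / (absRamificationIdx p (RescaledCompletion K p (w a₀) (hw a₀)) : ℤ) ≤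
      (v a - 1) / (absRamificationIdx p (RescaledCompletion K p (w a) (hw a)) : ℤ))
    (hroom : (((v a₀ - 1) % (absRamificationIdx p (RescaledCompletion K p (w a₀) (hw a₀)) : ℤ) + 1 : ℤ) : ℝ) /
        (absRamificationIdx p (RescaledCompletion K p (w a₀) (hw a₀)) : ℝ) +
      ∑ i ∈ Finset.univ \ S, (1 : ℝ) / (absRamificationIdx p (RescaledCompletion K p (w i) (hw i)) : ℝ) ≤ 1)
    (H : Subgroup (PacketAlgebra p (fun i => RescaledCompletion K p (w i) (hw i)) ≃ₗ[ℚ_[p]]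
      PacketAlgebra p (fun i => RescaledCompletion K p (w i) (hw i))))
    (hH : H ≤ indTwo p (fun i => RescaledCompletion K p (w i) (hw i)))
    (hstrip : ∀ (i₁ : I), ∀ ψ ∈ ind1StripOf (w i₁) (galoisLog (w i₁)), ∃ γ ∈ H,
      ∀ z : Π i, RescaledCompletion K p (w i) (hw i),
        (γ : PacketAlgebra p (fun i => RescaledCompletion K p (w i) (hw i)) ≃ₗ[ℚ_[p]]
            PacketAlgebra p (fun i => RescaledCompletion K p (w i) (hw i))) (PiTensorProduct.tprod ℚ_[p] z) =
          PiTensorProduct.tprod ℚ_[p] (update z i₁ (RescaledCompletion.of K p (w i₁) (hw i₁)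
            (ψ ((RescaledCompletion.of K p (w i₁) (hw i₁)).symm (z i₁)))))) :
    packetHull p (fun i => RescaledCompletion K p (w i) (hw i))
        (⋃ γ : H, (γ : PacketAlgebra p (fun i => RescaledCompletion K p (w i) (hw i)) ≃ₗ[ℚ_[p]]
            PacketAlgebra p (fun i => RescaledCompletion K p (w i) (hw i))) ''
          ⋃ a, iota p (fun i => RescaledCompletion K p (w i) (hw i)) a (g a) •
            (normalizedPacket p (fun i => RescaledCompletion K p (w i) (hw i)) :
              Set (PacketAlgebra p (fun i => RescaledCompletion K p (w i) (hw i))))) =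
      packetHull p (fun i => RescaledCompletion K p (w i) (hw i))
        (((p : ℚ_[p]) ^ (Finset.univ.inf' Finset.univ_nonempty
            (fun a => (v a - 1) / (absRamificationIdx p (RescaledCompletion K p (w a) (hw a)) : ℤ) + 1 - Fintype.card I))) •
          (logPacket p (fun i => RescaledCompletion K p (w i) (hw i)) :
            Set (PacketAlgebra p (fun i => RescaledCompletion K p (w i) (hw i))))) := by
  set k := fun i => RescaledCompletion K p (w i) (hw i) with hk
  set A : I → ℤ := fun a => (v a - 1) / (absRamificationIdx p (k a) : ℤ) + 1 - Fintype.card I with hA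
  obtain ⟨hsub, -⟩ := TameContent.content_iUnion_iota_smul_normalizedPacket p k hp2 he g v hg
  refine Set.Subset.antisymm (packetHull_iUnion_image_subset_of_subset_smul_logPacket p k hsub H hH) ?_
  -- the named slot `a₀` attains the minimum content
  have hmin : Finset.univ.inf' Finset.univ_nonempty A = A a₀ :=
    le_antisymm (Finset.inf'_le A (Finset.mem_univ a₀))
      (Finset.le_inf' Finset.univ_nonempty A fun a _ => by
        have := ha₀ a
        simp only [hA]
        linarith)
  -- R25 (A), transfer form, at the slot `a₀`
  have hcore := packetHull_iUnion_image_iota_smul_normalizedPacket_eq_of_bitsOn_of_jannsenWingbergMappingClass p w hw hMC hp2 he h3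
    hodd a₀ (hg a₀) S hroom hbit H hH hstrip
  change packetHull p k (((p : ℚ_[p]) ^ (Finset.univ.inf' Finset.univ_nonempty A)) • (logPacket p k : Set (PacketAlgebra p k))) ⊆ _
  rw [hmin, ← hcore]
  refine packetHull_mono p k (Set.iUnion_mono fun γ => Set.image_mono ?_)
  exact Set.subset_iUnion (fun a => iota p k a (g a) • (normalizedPacket p k : Set (PacketAlgebra p k))) a₀

/-! ## §2 Packet level: THE READING-(U) EQUIVALENCE -/

/-- **THE UNION ORBIT HULL IS THE CONTAINER ⟺ SOME CONTENT-MINIMISING SLOT HAS ROOM (tame, odd local degree `≥ 3`, ANY residue degrees; ⟸ mod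
`JannsenWingbergMappingClass`, ⟹ unconditional).**  With a bit oracle `bit` correct at the residue-degree-one factors (`hbit`, `hfix`) and
`S = {i : f_i ≠ 1 ∨ bit_i}`: for every `H ≤ indTwo` containing the single-factor strip moves and acting factorwise through the realised strip groups,
`packetHull(H-orbit of ⋃_a ι_a(g_a)·(R_I)^∼) = packetHull(p^{min_a A_a}·log_p(R_I^×)) ⟺ ∃ a, A_a = min_{a'} A_{a'} ∧ ((v_a−1) % e_a + 1)/e_a + Σ_{i∉S} 1/e_i ≤ 1`.
⟸ is §1 at that slot; ⟹ is the contrapositive of gen 21's (π′4) log-volume gap (every minimising slot failing its room puts `log μ̄(hull)` at least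
`(Σ_j f(L_j)/D)·log p > 0` below the container's).  MIXED collections (some minimising slots with room, some without) sit on the identity side.
[claim: Mochizuki2012, status: disputed] [cite: Mochizuki2012, IUTchIII Thm. 3.11 (i) p. 154; Cor. 3.12 p. 174, Step (xi) p. 183; IUTchIV Prop. 1.1 p. 9,
Prop. 1.2 (ii) pp. 10–11, Prop. 1.4 (iii) p. 13] [cite: Kondo2025OuterAutMLF, §3 Thm 3.17, Rem 3.18] [cite: DupuyHilado2025, §4.7, §4.9, §4.11, §4.12] -/
theorem packetHull_orbit_slotUnion_eq_container_iff_exists_room_at_min_of_jannsenWingbergMappingClass [Nonempty I]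
    (hMC : JannsenWingbergMappingClass) (hp2 : 2 < p)
    (he : ∀ i, absRamificationIdx p (RescaledCompletion K p (w i) (hw i)) ≤ p - 2)
    (h3 : ∀ i, 3 ≤ localDeg K (w i)) (hodd : ∀ i, Odd (localDeg K (w i)))
    (g : Π i, RescaledCompletion K p (w i) (hw i)) (v : I → ℤ)
    (hg : ∀ i, ‖g i‖ = (p : ℝ) ^ (-(v i / (absRamificationIdx p (RescaledCompletion K p (w i) (hw i)) : ℝ))))
    (bit : I → Prop) [DecidablePred bit]
    (hbit : ∀ i, (w i).asIdeal.inertiaDeg ℤ = 1 → bit i →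
      ∃ ψ ∈ ind1StripOf (w i) (galoisLog (w i)),
        RescaledCompletion.of K p (w i) (hw i) (ψ (p : (w i).adicCompletion K)) - (p : RescaledCompletion K p (w i) (hw i)) ∉
          (p : ℚ_[p]) • logUnits (RescaledCompletion K p (w i) (hw i)))
    (hfix : ∀ i, (w i).asIdeal.inertiaDeg ℤ = 1 → ¬ bit i → ∀ ψ ∈ ind1StripOf (w i) (galoisLog (w i)),
      RescaledCompletion.of K p (w i) (hw i) (ψ (p : (w i).adicCompletion K)) - (p : RescaledCompletion K p (w i) (hw i)) ∈
        (p : ℚ_[p]) • logUnits (RescaledCompletion K p (w i) (hw i)))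
    (H : Subgroup (PacketAlgebra p (fun i => RescaledCompletion K p (w i) (hw i)) ≃ₗ[ℚ_[p]]
      PacketAlgebra p (fun i => RescaledCompletion K p (w i) (hw i))))
    (hH : H ≤ indTwo p (fun i => RescaledCompletion K p (w i) (hw i)))
    (hstrip : ∀ (i₁ : I), ∀ ψ ∈ ind1StripOf (w i₁) (galoisLog (w i₁)), ∃ γ ∈ H,
      ∀ z : Π i, RescaledCompletion K p (w i) (hw i),
        (γ : PacketAlgebra p (fun i => RescaledCompletion K p (w i) (hw i)) ≃ₗ[ℚ_[p]]
            PacketAlgebra p (fun i => RescaledCompletion K p (w i) (hw i))) (PiTensorProduct.tprod ℚ_[p] z) =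
          PiTensorProduct.tprod ℚ_[p] (update z i₁ (RescaledCompletion.of K p (w i₁) (hw i₁)
            (ψ ((RescaledCompletion.of K p (w i₁) (hw i₁)).symm (z i₁))))))
    (hHfac : ∀ γ ∈ H, ∃ δ : Π i, AddAut ((w i).adicCompletion K),
      (∀ i, δ i ∈ AddSubgroup.closure (G := AddAut ((w i).adicCompletion K)) (ind1StripOf (w i) (galoisLog (w i)))) ∧
      ∀ z : Π i, RescaledCompletion K p (w i) (hw i),
        γ (PiTensorProduct.tprod ℚ_[p] z) =
          PiTensorProduct.tprod ℚ_[p] (fun i => RescaledCompletion.of K p (w i) (hw i)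
            (δ i ((RescaledCompletion.of K p (w i) (hw i)).symm (z i))))) :
    packetHull p (fun i => RescaledCompletion K p (w i) (hw i))
        (⋃ γ : H, (γ : PacketAlgebra p (fun i => RescaledCompletion K p (w i) (hw i)) ≃ₗ[ℚ_[p]]
            PacketAlgebra p (fun i => RescaledCompletion K p (w i) (hw i))) ''
          ⋃ a, iota p (fun i => RescaledCompletion K p (w i) (hw i)) a (g a) •
            (normalizedPacket p (fun i => RescaledCompletion K p (w i) (hw i)) :
              Set (PacketAlgebra p (fun i => RescaledCompletion K p (w i) (hw i))))) =
      packetHull p (fun i => RescaledCompletion K p (w i) (hw i))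
        (((p : ℚ_[p]) ^ (Finset.univ.inf' Finset.univ_nonempty
            (fun a => (v a - 1) / (absRamificationIdx p (RescaledCompletion K p (w a) (hw a)) : ℤ) + 1 - Fintype.card I))) •
          (logPacket p (fun i => RescaledCompletion K p (w i) (hw i)) :
            Set (PacketAlgebra p (fun i => RescaledCompletion K p (w i) (hw i))))) ↔
    ∃ a, (v a - 1) / (absRamificationIdx p (RescaledCompletion K p (w a) (hw a)) : ℤ) + 1 - Fintype.card I =
        Finset.univ.inf' Finset.univ_nonempty
          (fun a => (v a - 1) / (absRamificationIdx p (RescaledCompletion K p (w a) (hw a)) : ℤ) + 1 - Fintype.card I) ∧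
      (((v a - 1) % (absRamificationIdx p (RescaledCompletion K p (w a) (hw a)) : ℤ) + 1 : ℤ) : ℝ) /
          (absRamificationIdx p (RescaledCompletion K p (w a) (hw a)) : ℝ) +
        ∑ i ∈ Finset.univ \ Finset.univ.filter (fun i => (w i).asIdeal.inertiaDeg ℤ ≠ 1 ∨ bit i),
          (1 : ℝ) / (absRamificationIdx p (RescaledCompletion K p (w i) (hw i)) : ℝ) ≤ 1 := by
  classical
  set k := fun i => RescaledCompletion K p (w i) (hw i) with hk
  set S : Finset I := Finset.univ.filter (fun i => (w i).asIdeal.inertiaDeg ℤ ≠ 1 ∨ bit i) with hS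
  set A : I → ℤ := fun a => (v a - 1) / (absRamificationIdx p (k a) : ℤ) + 1 - Fintype.card I with hA
  have hmemS : ∀ i, i ∈ S ↔ (w i).asIdeal.inertiaDeg ℤ ≠ 1 ∨ bit i := fun i => by simp [hS]
  -- off `S`: residue degree one, the bit fails, `e_i = [K_{w_i} : ℚ_p] ≥ 3`
  have hfS : ∀ i, i ∉ S → (w i).asIdeal.inertiaDeg ℤ = 1 := fun i hi => by
    by_contra h; exact hi ((hmemS i).mpr (Or.inl h))
  have hbS : ∀ i, i ∉ S → ¬ bit i := fun i hi hb => hi ((hmemS i).mpr (Or.inr hb))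
  have he2 : ∀ i, i ∉ S → 2 ≤ absRamificationIdx p (RescaledCompletion K p (w i) (hw i)) := fun i hi => by
    have h := h3 i
    rw [localDeg, hfS i hi, mul_one, ← absRamificationIdx_rescaledCompletion K p (w i) (hw i)] at h
    omega
  constructor
  · intro hEq
    by_contra hnot
    have hnot' : ∀ a, A a = Finset.univ.inf' Finset.univ_nonempty A →
        ¬ ((((v a - 1) % (absRamificationIdx p (k a) : ℤ) + 1 : ℤ) : ℝ) / (absRamificationIdx p (k a) : ℝ) +
          ∑ i ∈ Finset.univ \ S, (1 : ℝ) / (absRamificationIdx p (k i) : ℝ) ≤ 1) :=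
      fun a ha hr => hnot ⟨a, ha, hr⟩
    obtain ⟨-, hle, -⟩ := packetLogμ_packetHull_orbit_slotUnion_le_container_sub_of_not_room_at_min p w hw hp2 he g v hg S he2 hfS
      (fun i hi => hfix i (hfS i hi) (hbS i hi)) hnot' H hHfac
    have hmar := margin_pos p k
    rw [hEq] at hle
    linarith
  · rintro ⟨a₀, ha₀, hroom⟩
    have hmin : ∀ a, (v a₀ - 1) / (absRamificationIdx p (k a₀) : ℤ) ≤ (v a - 1) / (absRamificationIdx p (k a) : ℤ) := by
      intro a
      have h1 : Finset.univ.inf' Finset.univ_nonempty A ≤ A a := Finset.inf'_le A (Finset.mem_univ a)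
      have h2 : A a₀ = Finset.univ.inf' Finset.univ_nonempty A := ha₀
      simp only [hA] at h1 h2
      omega
    exact packetHull_iUnion_image_iUnion_iota_smul_normalizedPacket_eq_of_bitsOn_at_min_of_jannsenWingbergMappingClass p w hw hMC hp2 he h3
      hodd g v hg S (fun i hi hf1 => hbit i hf1 (((hmemS i).mp hi).resolve_left (fun h => h hf1))) a₀ hmin hroom H hH hstrip

end GenuineFactors

/-! ## §3 Place-section level: the genuine collections of a place section -/

section PlaceSection

variable {F₀ : Type} [Field F₀] [NumberField F₀] {K : Type} [Field K] [NumberField K] [Algebra F₀ K]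
variable (σ : PlaceSection F₀ K) (p : ℕ) [hp : Fact p.Prime]
variable (c : (j : ℕ) → (Fin (j + 1) → placesOver F₀ p) → ℚ_[p]) (hc0 : ∀ j e, c j e ≠ 0)
  (hcσ : ∀ (j : ℕ) (τ : Equiv.Perm (Fin (j + 1))) (e : Fin (j + 1) → placesOver F₀ p), c j (e ∘ τ) = c j e)

/-- **THE UNION IDENTITY FROM BITS ON `S` AND ROOM AT ONE CONTENT-MINIMISING SLOT, place-section level (modulo `JannsenWingbergMappingClass`).**  Real prime
packet over the GENUINE completions of a place section (any shell normalisation `c`), Θ-idele `t`, degree `j = i+1`, collection `v⃗ = e` with every factor TAME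
of ODD local degree `≥ 3`, slot valuations `‖t_{i,v_a}‖ = p^{−v_a/e(v̲_a|p)}`; bits available on `S`; `a₀` content-minimising with room.  For every `H ≤ indTwo`
containing the single-factor (Ind1) strip moves, the `(R_I)^∼`-hull of the `H`-orbit of the (Ind1)-slot union `⋃_σ σ·O_𝕃(−P_Θ)_{v⃗∘σ}` EQUALS the hull of
ALL possible images. [claim: Mochizuki2012, status: disputed] [cite: Mochizuki2012, IUTchIII Thm. 3.11 (i) p. 154; Cor. 3.12 p. 174; IUTchIV Prop. 1.2 (ii) pp. 10–11]
[cite: Kondo2025OuterAutMLF, §3 Thm 3.17, Rem 3.18] [cite: DupuyHilado2025, §4.7, §4.9, §4.11, §4.12] -/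
theorem localFields_packetHull_orbitH_indOneUnion_pilotRegion_eq_possibleImagesHull_of_bitsOn_at_min_of_jannsenWingbergMappingClass
    (hMC : JannsenWingbergMappingClass) (hp2 : 2 < p) {lstar : ℕ}
    (t : Fin lstar → (v : placesOver F₀ p) → ((σ.localFields p).k v)ˣ) (i : Fin lstar)
    (e : Fin ((i : ℕ) + 1 + 1) → placesOver F₀ p)
    (he : ∀ b, absRamificationIdx p ((σ.localFields p).k (e b)) ≤ p - 2)
    (h3 : ∀ b, 3 ≤ localDeg K (σ.lift (e b).1)) (hodd : ∀ b, Odd (localDeg K (σ.lift (e b).1)))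
    (v : Fin ((i : ℕ) + 1 + 1) → ℤ)
    (hv : ∀ a, ‖(t i (e a) : (σ.localFields p).k (e a))‖ =
      (p : ℝ) ^ (-(v a / (absRamificationIdx p ((σ.localFields p).k (e a)) : ℝ))))
    (S : Finset (Fin ((i : ℕ) + 1 + 1)))
    (hbit : ∀ b ∈ S, (σ.lift (e b).1).asIdeal.inertiaDeg ℤ = 1 →
      ∃ ψ ∈ ind1StripOf (σ.lift (e b).1) (galoisLog (σ.lift (e b).1)),
        RescaledCompletion.of K p (σ.lift (e b).1) (σ.natCast_mem_lift (e b)) (ψ (p : (σ.lift (e b).1).adicCompletion K)) -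
            (p : RescaledCompletion K p (σ.lift (e b).1) (σ.natCast_mem_lift (e b))) ∉
          (p : ℚ_[p]) • logUnits (RescaledCompletion K p (σ.lift (e b).1) (σ.natCast_mem_lift (e b))))
    (a₀ : Fin ((i : ℕ) + 1 + 1))
    (ha₀ : ∀ a, (v a₀ - 1) / (absRamificationIdx p ((σ.localFields p).k (e a₀)) : ℤ) ≤
      (v a - 1) / (absRamificationIdx p ((σ.localFields p).k (e a)) : ℤ))
    (hroom : (((v a₀ - 1) % (absRamificationIdx p ((σ.localFields p).k (e a₀)) : ℤ) + 1 : ℤ) : ℝ) /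
        (absRamificationIdx p ((σ.localFields p).k (e a₀)) : ℝ) +
      ∑ b ∈ Finset.univ \ S, (1 : ℝ) / (absRamificationIdx p ((σ.localFields p).k (e b)) : ℝ) ≤ 1)
    (H : Subgroup (PacketAlgebra p (fun b => (σ.localFields p).k (e b)) ≃ₗ[ℚ_[p]]
      PacketAlgebra p (fun b => (σ.localFields p).k (e b))))
    (hH : H ≤ indTwo p (fun b => (σ.localFields p).k (e b)))
    (hstrip : ∀ (b₀ : Fin ((i : ℕ) + 1 + 1)),
      ∀ ψ ∈ ind1StripOf (σ.lift (e b₀).1) (galoisLog (σ.lift (e b₀).1)), ∃ γ ∈ H,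
        ∀ z : ∀ b, (σ.localFields p).k (e b),
          (γ : PacketAlgebra p (fun b => (σ.localFields p).k (e b)) ≃ₗ[ℚ_[p]]
              PacketAlgebra p (fun b => (σ.localFields p).k (e b))) (PiTensorProduct.tprod ℚ_[p] z) =
            PiTensorProduct.tprod ℚ_[p] (update z b₀
              (RescaledCompletion.of K p (σ.lift (e b₀).1) (σ.natCast_mem_lift (e b₀))
                (ψ ((RescaledCompletion.of K p (σ.lift (e b₀).1) (σ.natCast_mem_lift (e b₀))).symm (z b₀)))))) :
    packetHull p (fun b => (σ.localFields p).k (e b))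
        (⋃ γ : H, (γ : PacketAlgebra p (fun b => (σ.localFields p).k (e b)) ≃ₗ[ℚ_[p]]
            PacketAlgebra p (fun b => (σ.localFields p).k (e b))) ''
          ⋃ τ : Equiv.Perm (Fin ((i : ℕ) + 1 + 1)), (realPrimePacketWith p (σ.localFields p) c hc0 hcσ).perm τ e ''
            (realPrimePacketWith p (σ.localFields p) c hc0 hcσ).pilotRegion t ((i : ℕ) + 1) (e ∘ τ)) =
      (realPrimePacketWith p (σ.localFields p) c hc0 hcσ).possibleImagesHull
        ((realPrimePacketWith p (σ.localFields p) c hc0 hcσ).pilotRegion t) ((i : ℕ) + 1) e := by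
  haveI : Nonempty (Fin ((i : ℕ) + 1 + 1)) := ⟨Fin.last _⟩
  have hcore := packetHull_iUnion_image_iUnion_iota_smul_normalizedPacket_eq_of_bitsOn_at_min_of_jannsenWingbergMappingClass p
    (fun b => σ.lift (e b).1) (fun b => σ.natCast_mem_lift (e b)) hMC hp2 he h3 hodd
    (fun a => (t i (e a) : (σ.localFields p).k (e a))) v hv S hbit a₀ ha₀ hroom H hH hstrip
  have hcont := TameContent.packetHull_orbit_iUnion_iota_smul_normalizedPacket_eq p (fun b => (σ.localFields p).k (e b)) hp2 he
    (fun a => (t i (e a) : (σ.localFields p).k (e a))) v hv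
  have hU : (⋃ τ : Equiv.Perm (Fin ((i : ℕ) + 1 + 1)),
      ((realPrimePacketWith p (σ.localFields p) c hc0 hcσ).perm τ e ''
          (realPrimePacketWith p (σ.localFields p) c hc0 hcσ).pilotRegion t ((i : ℕ) + 1) (e ∘ τ) :
        Set (PacketAlgebra p (fun b => (σ.localFields p).k (e b))))) =
      ⋃ a : Fin ((i : ℕ) + 1 + 1), iota p (fun b => (σ.localFields p).k (e b)) a (t i (e a) : (σ.localFields p).k (e a)) •
        (normalizedPacket p (fun b => (σ.localFields p).k (e b)) : Set (PacketAlgebra p (fun b => (σ.localFields p).k (e b)))) :=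
    realPrimePacketWith_indOneUnion_pilotRegion_eq_slotUnion p (σ.localFields p) c hc0 hcσ t i e
  change packetHull p _ (⋃ γ : H, (γ : PacketAlgebra p (fun b => (σ.localFields p).k (e b)) ≃ₗ[ℚ_[p]]
      PacketAlgebra p (fun b => (σ.localFields p).k (e b))) '' ⋃ τ : Equiv.Perm (Fin ((i : ℕ) + 1 + 1)),
      ((realPrimePacketWith p (σ.localFields p) c hc0 hcσ).perm τ e ''
          (realPrimePacketWith p (σ.localFields p) c hc0 hcσ).pilotRegion t ((i : ℕ) + 1) (e ∘ τ) :
        Set (PacketAlgebra p (fun b => (σ.localFields p).k (e b))))) =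
    packetHull p _ ((realPrimePacketWith p (σ.localFields p) c hc0 hcσ).possibleImages _ _ e)
  rw [hU, realPrimePacketWith_possibleImages_pilotRegion_eq]
  exact hcore.trans hcont.symm

/-- **READING (U) AT A GENUINE COLLECTION: hull of the `H`-orbit of the (Ind1)-slot union = possibleImagesHull ⟺ SOME CONTENT-MINIMISING SLOT HAS ROOM
(⟸ mod `JannsenWingbergMappingClass`, ⟹ unconditional).**  Collection `v⃗ = e` of a place section, every factor TAME of ODD local degree `≥ 3`, ANY residue
degrees, slot valuations `‖t_{i,v_a}‖ = p^{−v_a/e(v̲_a|p)}`; bit oracle `bit` correct at the residue-degree-one factors, `S = {b : f(v̲_b|p) ≠ 1 ∨ bit_b}`; `H ≤ indTwo`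
containing the single-factor strip moves and acting factorwise through the realised strip groups.  §2 transported along abc-iut-c312-3's
`realPrimePacketWith_indOneUnion_pilotRegion_eq_slotUnion` and R23's `realPrimePacketWith_possibleImagesHull_pilotRegion_eq_of_tame`.
[claim: Mochizuki2012, status: disputed] [cite: Mochizuki2012, IUTchIII Thm. 3.11 (i) p. 154; Cor. 3.12 p. 174; IUTchIV Prop. 1.2 (ii) pp. 10–11, Prop. 1.4 (iii) p. 13]
[cite: Kondo2025OuterAutMLF, §3 Thm 3.17, Rem 3.18] [cite: DupuyHilado2025, §4.7, §4.9, §4.11, §4.12] -/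
theorem localFields_packetHull_orbitH_indOneUnion_pilotRegion_eq_possibleImagesHull_iff_exists_room_at_min_of_jannsenWingbergMappingClass
    (hMC : JannsenWingbergMappingClass) (hp2 : 2 < p) {lstar : ℕ}
    (t : Fin lstar → (v : placesOver F₀ p) → ((σ.localFields p).k v)ˣ) (i : Fin lstar)
    (e : Fin ((i : ℕ) + 1 + 1) → placesOver F₀ p)
    (he : ∀ b, absRamificationIdx p ((σ.localFields p).k (e b)) ≤ p - 2)
    (h3 : ∀ b, 3 ≤ localDeg K (σ.lift (e b).1)) (hodd : ∀ b, Odd (localDeg K (σ.lift (e b).1)))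
    (v : Fin ((i : ℕ) + 1 + 1) → ℤ)
    (hv : ∀ a, ‖(t i (e a) : (σ.localFields p).k (e a))‖ =
      (p : ℝ) ^ (-(v a / (absRamificationIdx p ((σ.localFields p).k (e a)) : ℝ))))
    (bit : Fin ((i : ℕ) + 1 + 1) → Prop) [DecidablePred bit]
    (hbit : ∀ b, (σ.lift (e b).1).asIdeal.inertiaDeg ℤ = 1 → bit b →
      ∃ ψ ∈ ind1StripOf (σ.lift (e b).1) (galoisLog (σ.lift (e b).1)),
        RescaledCompletion.of K p (σ.lift (e b).1) (σ.natCast_mem_lift (e b)) (ψ (p : (σ.lift (e b).1).adicCompletion K)) -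
            (p : RescaledCompletion K p (σ.lift (e b).1) (σ.natCast_mem_lift (e b))) ∉
          (p : ℚ_[p]) • logUnits (RescaledCompletion K p (σ.lift (e b).1) (σ.natCast_mem_lift (e b))))
    (hfix : ∀ b, (σ.lift (e b).1).asIdeal.inertiaDeg ℤ = 1 → ¬ bit b →
      ∀ ψ ∈ ind1StripOf (σ.lift (e b).1) (galoisLog (σ.lift (e b).1)),
        RescaledCompletion.of K p (σ.lift (e b).1) (σ.natCast_mem_lift (e b)) (ψ (p : (σ.lift (e b).1).adicCompletion K)) -
            (p : RescaledCompletion K p (σ.lift (e b).1) (σ.natCast_mem_lift (e b))) ∈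
          (p : ℚ_[p]) • logUnits (RescaledCompletion K p (σ.lift (e b).1) (σ.natCast_mem_lift (e b))))
    (H : Subgroup (PacketAlgebra p (fun b => (σ.localFields p).k (e b)) ≃ₗ[ℚ_[p]]
      PacketAlgebra p (fun b => (σ.localFields p).k (e b))))
    (hH : H ≤ indTwo p (fun b => (σ.localFields p).k (e b)))
    (hstrip : ∀ (b₀ : Fin ((i : ℕ) + 1 + 1)),
      ∀ ψ ∈ ind1StripOf (σ.lift (e b₀).1) (galoisLog (σ.lift (e b₀).1)), ∃ γ ∈ H,
        ∀ z : ∀ b, (σ.localFields p).k (e b),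
          (γ : PacketAlgebra p (fun b => (σ.localFields p).k (e b)) ≃ₗ[ℚ_[p]]
              PacketAlgebra p (fun b => (σ.localFields p).k (e b))) (PiTensorProduct.tprod ℚ_[p] z) =
            PiTensorProduct.tprod ℚ_[p] (update z b₀
              (RescaledCompletion.of K p (σ.lift (e b₀).1) (σ.natCast_mem_lift (e b₀))
                (ψ ((RescaledCompletion.of K p (σ.lift (e b₀).1) (σ.natCast_mem_lift (e b₀))).symm (z b₀))))))
    (hHfac : ∀ γ ∈ H, ∃ δ : Π b, AddAut ((σ.lift (e b).1).adicCompletion K),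
      (∀ b, δ b ∈ AddSubgroup.closure (G := AddAut ((σ.lift (e b).1).adicCompletion K))
        (ind1StripOf (σ.lift (e b).1) (galoisLog (σ.lift (e b).1)))) ∧
      ∀ z : Π b, (σ.localFields p).k (e b),
        (γ : PacketAlgebra p (fun b => (σ.localFields p).k (e b)) ≃ₗ[ℚ_[p]]
            PacketAlgebra p (fun b => (σ.localFields p).k (e b))) (PiTensorProduct.tprod ℚ_[p] z) =
          PiTensorProduct.tprod ℚ_[p] (fun b => RescaledCompletion.of K p (σ.lift (e b).1) (σ.natCast_mem_lift (e b))
            (δ b ((RescaledCompletion.of K p (σ.lift (e b).1) (σ.natCast_mem_lift (e b))).symm (z b))))) :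
    packetHull p (fun b => (σ.localFields p).k (e b))
        (⋃ γ : H, (γ : PacketAlgebra p (fun b => (σ.localFields p).k (e b)) ≃ₗ[ℚ_[p]]
            PacketAlgebra p (fun b => (σ.localFields p).k (e b))) ''
          ⋃ τ : Equiv.Perm (Fin ((i : ℕ) + 1 + 1)), (realPrimePacketWith p (σ.localFields p) c hc0 hcσ).perm τ e ''
            (realPrimePacketWith p (σ.localFields p) c hc0 hcσ).pilotRegion t ((i : ℕ) + 1) (e ∘ τ)) =
      (realPrimePacketWith p (σ.localFields p) c hc0 hcσ).possibleImagesHull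
        ((realPrimePacketWith p (σ.localFields p) c hc0 hcσ).pilotRegion t) ((i : ℕ) + 1) e ↔
    ∃ a, (v a - 1) / (absRamificationIdx p ((σ.localFields p).k (e a)) : ℤ) + 1 - Fintype.card (Fin ((i : ℕ) + 1 + 1)) =
        Finset.univ.inf' Finset.univ_nonempty
          (fun a => (v a - 1) / (absRamificationIdx p ((σ.localFields p).k (e a)) : ℤ) + 1 - Fintype.card (Fin ((i : ℕ) + 1 + 1))) ∧
      (((v a - 1) % (absRamificationIdx p ((σ.localFields p).k (e a)) : ℤ) + 1 : ℤ) : ℝ) /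
          (absRamificationIdx p ((σ.localFields p).k (e a)) : ℝ) +
        ∑ b ∈ Finset.univ \ Finset.univ.filter (fun b => (σ.lift (e b).1).asIdeal.inertiaDeg ℤ ≠ 1 ∨ bit b),
          (1 : ℝ) / (absRamificationIdx p ((σ.localFields p).k (e b)) : ℝ) ≤ 1 := by
  haveI : Nonempty (Fin ((i : ℕ) + 1 + 1)) := ⟨Fin.last _⟩
  have hU : (⋃ τ : Equiv.Perm (Fin ((i : ℕ) + 1 + 1)),
      ((realPrimePacketWith p (σ.localFields p) c hc0 hcσ).perm τ e ''
          (realPrimePacketWith p (σ.localFields p) c hc0 hcσ).pilotRegion t ((i : ℕ) + 1) (e ∘ τ) :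
        Set (PacketAlgebra p (fun b => (σ.localFields p).k (e b))))) =
      ⋃ a : Fin ((i : ℕ) + 1 + 1), iota p (fun b => (σ.localFields p).k (e b)) a (t i (e a) : (σ.localFields p).k (e a)) •
        (normalizedPacket p (fun b => (σ.localFields p).k (e b)) : Set (PacketAlgebra p (fun b => (σ.localFields p).k (e b)))) :=
    realPrimePacketWith_indOneUnion_pilotRegion_eq_slotUnion p (σ.localFields p) c hc0 hcσ t i e
  -- the left-hand equation, rewritten at the packet
  have hL : (packetHull p (fun b => (σ.localFields p).k (e b))
        (⋃ γ : H, (γ : PacketAlgebra p (fun b => (σ.localFields p).k (e b)) ≃ₗ[ℚ_[p]]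
            PacketAlgebra p (fun b => (σ.localFields p).k (e b))) ''
          ⋃ τ : Equiv.Perm (Fin ((i : ℕ) + 1 + 1)), (realPrimePacketWith p (σ.localFields p) c hc0 hcσ).perm τ e ''
            (realPrimePacketWith p (σ.localFields p) c hc0 hcσ).pilotRegion t ((i : ℕ) + 1) (e ∘ τ)) =
      (realPrimePacketWith p (σ.localFields p) c hc0 hcσ).possibleImagesHull
        ((realPrimePacketWith p (σ.localFields p) c hc0 hcσ).pilotRegion t) ((i : ℕ) + 1) e) ↔
      (packetHull p (fun b => (σ.localFields p).k (e b))
        (⋃ γ : H, (γ : PacketAlgebra p (fun b => (σ.localFields p).k (e b)) ≃ₗ[ℚ_[p]]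
            PacketAlgebra p (fun b => (σ.localFields p).k (e b))) ''
          ⋃ a : Fin ((i : ℕ) + 1 + 1), iota p (fun b => (σ.localFields p).k (e b)) a (t i (e a) : (σ.localFields p).k (e a)) •
            (normalizedPacket p (fun b => (σ.localFields p).k (e b)) : Set (PacketAlgebra p (fun b => (σ.localFields p).k (e b))))) =
      packetHull p (fun b => (σ.localFields p).k (e b))
        (((p : ℚ_[p]) ^ (Finset.univ.inf' Finset.univ_nonempty
            (fun a => (v a - 1) / (absRamificationIdx p ((σ.localFields p).k (e a)) : ℤ) + 1 - Fintype.card (Fin ((i : ℕ) + 1 + 1))))) •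
          (logPacket p (fun b => (σ.localFields p).k (e b)) : Set (PacketAlgebra p (fun b => (σ.localFields p).k (e b)))))) := by
    rw [← realPrimePacketWith_possibleImagesHull_pilotRegion_eq_of_tame p (σ.localFields p) c hc0 hcσ hp2 t i e he v hv, hU]
  rw [hL]
  exact packetHull_orbit_slotUnion_eq_container_iff_exists_room_at_min_of_jannsenWingbergMappingClass p
    (fun b => σ.lift (e b).1) (fun b => σ.natCast_mem_lift (e b)) hMC hp2 he h3 hodd
    (fun a => (t i (e a) : (σ.localFields p).k (e a))) v hv bit hbit hfix H hH hstrip hHfac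

end PlaceSection

end Summit.ABC.IUTFork.Thm311.Real

end
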